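import Summits.AtomisticToContinuum.Crystallization.Theorems.PricedLinkCensusChargedPeriodicIsOptimalPacking
import Summits.AtomisticToContinuum.Crystallization.Theorems.PricedLinkCensusChargedPeriodicIsOptimalBlock

/-!
# `ChargedPeriodicIsOptimal` (stmt-AtomisticToContinuum-2913), helpers III: excision bookkeeping

The energy bookkeeping of the excision argument for item 2913
(`PricedLinkCensus.ChargedPeriodicIsOptimal`), Lennard-Jones in `ℝ³`:

* `two_mul_energy_ge_excision` — removing pairwise disjoint patches `P t` (`t ∈ T`) from an
  injective configuration `y`:
  `2E(y) ≥ 2E(#rest) + Σ_t ΣΣ_{P t × P t} V − (1/3) Σ_t Σ_{a ∈ P t} Σ_{b ∉ P t} |y_a − y_b|⁻⁶`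
  (full double sum split along `S = ⋃ P t`; the rest costs at least `E(#rest)`; every cross
  term is `≥ −r⁻⁶/6`);
* `sum_sum_image_eq_two_mul_energy` — the double sum over an embedded patch is twice the
  energy of the patch configuration;
* the PATCH of a good particle: given the one-sided matching
  `dist (y (φ u)) (y t + A (bpt u + g − q)) ≤ ε` of block points, `φ` is injective
  (`patch_injective`), the patch lies within `R₀ + ε` of `y t` (`dist_patch_center_le`), and —
  with the converse matching inside radius `R` — the sixth-power cross sum of the patch with
  all other particles is at most `64 Σ_u tailSix u + n · 250 δ⁻⁵/T` (`patch_cross_le`);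
* real-number bookkeeping of the final comparison (`patch_budget`, `thermo_bookkeeping`) and
  the choice of `⌊cN⌋` well-separated good particles (`exists_separated_subfamily`, from the
  packing lemmas of part I).

All `[folklore]`.
-/

noncomputable section

namespace Summit.AtomisticToContinuum.Crystallization.Theorems.ChargedPeriodicOptimal

open Literature.MathematicalPhysics.StatisticalMechanics
open Summit.AtomisticToContinuum.Crystallization.Theorems.ChargedEnergyGapNegative
open Summit.AtomisticToContinuum.Crystallization.Theorems.ChargedEnergyGapNegative.Blocks
open scoped BigOperators
open Metric

/-! ## The excision inequality -/

/-- Pointwise: `V_LJ(|y_a − y_b|) ≥ −(1/6)|y_a − y_b|⁻⁶` for all `a, b` (for `a = b` both sides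
vanish with Lean's `0⁻¹ = 0`). [folklore] -/
theorem neg_six_dist_le {N : ℕ} (y : Fin N → E3) (a b : Fin N) :
    -(1 / 6 * (dist (y a) (y b))⁻¹ ^ 6) ≤ lennardJones (dist (y a) (y b)) := by
  rcases eq_or_lt_of_le (dist_nonneg : 0 ≤ dist (y a) (y b)) with h | h
  · rw [← h, lennardJones_zero]; simp
  · exact neg_le_lennardJones_of_le h le_rfl

/-- **The excision inequality.** For an injective configuration `y` of `N` points of `ℝ³` and
pairwise disjoint patches `P t`, `t ∈ T`, with `S = ⋃_t P t`:
`2·E(#Sᶜ) + Σ_t Σ_{a,b ∈ P t} V(|y_a − y_b|) − (1/3) Σ_t Σ_{a ∈ P t} Σ_{b ∉ P t} |y_a − y_b|⁻⁶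
≤ 2·𝓔(y)` (Lennard-Jones). [folklore] -/
theorem two_mul_energy_ge_excision {N : ℕ} {y : Fin N → E3} (hy : Function.Injective y)
    (T : Finset (Fin N)) (P : Fin N → Finset (Fin N))
    (hdisj : (T : Set (Fin N)).PairwiseDisjoint P) :
    2 * groundStateEnergy lennardJones 3 (T.biUnion P)ᶜ.card +
        ∑ t ∈ T, ∑ a ∈ P t, ∑ b ∈ P t, lennardJones (dist (y a) (y b)) -
        1 / 3 * ∑ t ∈ T, ∑ a ∈ P t, ∑ b ∈ (P t)ᶜ, (dist (y a) (y b))⁻¹ ^ 6 ≤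
      2 * interactionEnergy lennardJones y := by
  classical
  have hG0 : ∀ a b : Fin N, 0 ≤ (dist (y a) (y b))⁻¹ ^ 6 := fun a b => by positivity
  have h2 := two_mul_interactionEnergy_eq_sum_sum lennardJones lennardJones_zero y
  rw [sum_sum_eq_add_compl _ (T.biUnion P)] at h2
  -- the rest costs at least `E(#Sᶜ)`
  have hrest := two_mul_groundStateEnergy_card_le lennardJones lennardJones_zero
    neg_one_div_le_lennardJones hy (T.biUnion P)ᶜ
  -- symmetry of the cross block
  have hsymm : ∑ a ∈ (T.biUnion P)ᶜ, ∑ b ∈ T.biUnion P, lennardJones (dist (y a) (y b)) =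
      ∑ a ∈ T.biUnion P, ∑ b ∈ (T.biUnion P)ᶜ, lennardJones (dist (y a) (y b)) := by
    rw [Finset.sum_comm]
    exact Finset.sum_congr rfl fun a _ => Finset.sum_congr rfl fun b _ => by rw [dist_comm]
  -- sums over `S = ⋃ P t` are sums over the patches
  have hSsum : ∀ f : Fin N → ℝ, ∑ a ∈ T.biUnion P, f a = ∑ t ∈ T, ∑ a ∈ P t, f a := fun f =>
    Finset.sum_biUnion hdisj
  have hPS : ∀ t ∈ T, P t ⊆ T.biUnion P := fun t ht => Finset.subset_biUnion_of_mem P ht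
  -- per patch point: block row plus twice the outside row
  have hrow : ∀ t ∈ T, ∀ a ∈ P t,
      ∑ b ∈ P t, lennardJones (dist (y a) (y b)) -
          1 / 3 * ∑ b ∈ (P t)ᶜ, (dist (y a) (y b))⁻¹ ^ 6 ≤
        ∑ b ∈ T.biUnion P, lennardJones (dist (y a) (y b)) +
          2 * ∑ b ∈ (T.biUnion P)ᶜ, lennardJones (dist (y a) (y b)) := by
    intro t ht a _
    have hsplit : ∑ b ∈ T.biUnion P, lennardJones (dist (y a) (y b)) =
        ∑ b ∈ P t, lennardJones (dist (y a) (y b)) +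
          ∑ b ∈ T.biUnion P \ P t, lennardJones (dist (y a) (y b)) := by
      rw [← Finset.sum_sdiff (hPS t ht), add_comm]
    have hcompl : ∑ b ∈ (P t)ᶜ, (dist (y a) (y b))⁻¹ ^ 6 =
        ∑ b ∈ T.biUnion P \ P t, (dist (y a) (y b))⁻¹ ^ 6 +
          ∑ b ∈ (T.biUnion P)ᶜ, (dist (y a) (y b))⁻¹ ^ 6 := by
      have hd : Disjoint (T.biUnion P \ P t) (T.biUnion P)ᶜ := by
        rw [Finset.disjoint_left]
        intro b hb hb'
        exact (Finset.mem_compl.1 hb') (Finset.mem_sdiff.1 hb).1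
      have hu : (P t)ᶜ = (T.biUnion P \ P t) ∪ (T.biUnion P)ᶜ := by
        ext b
        simp only [Finset.mem_compl, Finset.mem_union, Finset.mem_sdiff]
        constructor
        · intro hb
          by_cases hbS : b ∈ T.biUnion P
          · exact Or.inl ⟨hbS, hb⟩
          · exact Or.inr hbS
        · rintro (⟨-, hb⟩ | hb)
          · exact hb
          · exact fun h => hb (hPS t ht h)
      rw [hu, Finset.sum_union hd]
    have h1 : -(1 / 6 * ∑ b ∈ T.biUnion P \ P t, (dist (y a) (y b))⁻¹ ^ 6) ≤
        ∑ b ∈ T.biUnion P \ P t, lennardJones (dist (y a) (y b)) := by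
      rw [Finset.mul_sum, ← Finset.sum_neg_distrib]
      exact Finset.sum_le_sum fun b _ => neg_six_dist_le y a b
    have h2 : -(1 / 6 * ∑ b ∈ (T.biUnion P)ᶜ, (dist (y a) (y b))⁻¹ ^ 6) ≤
        ∑ b ∈ (T.biUnion P)ᶜ, lennardJones (dist (y a) (y b)) := by
      rw [Finset.mul_sum, ← Finset.sum_neg_distrib]
      exact Finset.sum_le_sum fun b _ => neg_six_dist_le y a b
    have h3 : 0 ≤ ∑ b ∈ T.biUnion P \ P t, (dist (y a) (y b))⁻¹ ^ 6 :=
      Finset.sum_nonneg fun b _ => hG0 a b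
    rw [hsplit, hcompl]
    linarith
  have hmain := Finset.sum_le_sum fun t ht => Finset.sum_le_sum fun a ha => hrow t ht a ha
  have hR : ∑ t ∈ T, ∑ a ∈ P t, (∑ b ∈ T.biUnion P, lennardJones (dist (y a) (y b)) +
        2 * ∑ b ∈ (T.biUnion P)ᶜ, lennardJones (dist (y a) (y b))) =
      ∑ a ∈ T.biUnion P, ∑ b ∈ T.biUnion P, lennardJones (dist (y a) (y b)) +
        2 * ∑ a ∈ T.biUnion P, ∑ b ∈ (T.biUnion P)ᶜ, lennardJones (dist (y a) (y b)) := by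
    rw [← hSsum, Finset.sum_add_distrib, Finset.mul_sum]
  have hL : ∑ t ∈ T, ∑ a ∈ P t, (∑ b ∈ P t, lennardJones (dist (y a) (y b)) -
        1 / 3 * ∑ b ∈ (P t)ᶜ, (dist (y a) (y b))⁻¹ ^ 6) =
      ∑ t ∈ T, ∑ a ∈ P t, ∑ b ∈ P t, lennardJones (dist (y a) (y b)) -
        1 / 3 * ∑ t ∈ T, ∑ a ∈ P t, ∑ b ∈ (P t)ᶜ, (dist (y a) (y b))⁻¹ ^ 6 := by
    simp only [Finset.sum_sub_distrib, Finset.mul_sum]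
  rw [hR, hL] at hmain
  rw [hsymm] at h2
  linarith

/-- **The double sum over an embedded patch is twice the patch energy**: for an injective
`φ` from the block index type, `Σ_{a,b ∈ im φ} V(|y_a − y_b|) = 2·𝓔(y ∘ φ ∘ e⁻¹)`
(`e` the enumeration of the block index type). [folklore] -/
theorem sum_sum_image_eq_two_mul_energy (Q : PeriodicConfiguration 3) (K : ℕ) {N : ℕ}
    (y : Fin N → E3) {φ : BIdx Q K → Fin N} (hφ : Function.Injective φ) :
    ∑ a ∈ Finset.univ.image φ, ∑ b ∈ Finset.univ.image φ, lennardJones (dist (y a) (y b)) =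
      2 * interactionEnergy lennardJones ((y ∘ φ) ∘ (Fintype.equivFin (BIdx Q K)).symm) := by
  classical
  set e := (Fintype.equivFin (BIdx Q K)).symm with he
  rw [two_mul_interactionEnergy_eq_sum_sum lennardJones lennardJones_zero,
    Finset.sum_image fun a _ b _ h => hφ h]
  simp_rw [Finset.sum_image fun a _ b _ h => hφ h]
  simp only [Function.comp_apply]
  rw [← e.sum_comp]
  exact Finset.sum_congr rfl fun i _ => (e.sum_comp (fun v => lennardJones
    (dist (y (φ (e i))) (y (φ v))))).symm

/-! ## The patch of a good particle -/

section Patch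

variable (Q : PeriodicConfiguration 3) (K : ℕ) {N : ℕ} {y : Fin N → E3}
variable {δL δQ ε : ℝ} {t : Fin N} {A : E3 →ₗᵢ[ℝ] E3} {y' g : E3} {φ : BIdx Q K → Fin N}

/-- Distances of images under a linear isometry followed by a translation. [folklore] -/
theorem dist_translate_map (c : E3) (A : E3 →ₗᵢ[ℝ] E3) (v w : E3) :
    dist (c + A v) (c + A w) = dist v w := by
  rw [dist_add_left, A.isometry.dist_eq]

/-- **The patch map is injective** (two block points matched to one particle would be within
`2ε < δ_Q` of each other). [folklore] -/
theorem patch_injective (hsepQ : ∀ s ∈ Q.points, ∀ s' ∈ Q.points, s ≠ s' → δQ ≤ dist s s')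
    (hε : 2 * ε < δQ)
    (hφ : ∀ u, dist (y (φ u)) (y t + A (bpt Q K u + g - (y' + g))) ≤ ε) :
    Function.Injective φ := by
  intro u v huv
  by_contra hne
  have hpts : bpt Q K u ≠ bpt Q K v := (bpt_injective Q K).ne hne
  have hfar : δQ ≤ dist (bpt Q K u) (bpt Q K v) :=
    hsepQ _ (bpt_mem Q K u) _ (bpt_mem Q K v) hpts
  have h1 := hφ u
  have h2 := hφ v
  rw [huv] at h1
  have h3 := dist_triangle_left (y t + A (bpt Q K u + g - (y' + g)))
    (y t + A (bpt Q K v + g - (y' + g))) (y (φ v))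
  rw [dist_translate_map] at h3
  have h4 : dist (bpt Q K u + g - (y' + g)) (bpt Q K v + g - (y' + g)) =
      dist (bpt Q K u) (bpt Q K v) := by
    rw [dist_eq_norm, dist_eq_norm]; congr 1; abel
  rw [h4] at h3
  linarith

/-- **The patch stays near its centre**: `dist (y (φ u)) (y t) ≤ R₀ + ε` when block points are
within `R₀` of the motif point `y'`. [folklore] -/
theorem dist_patch_center_le {R₀ : ℝ} (hR₀ : ∀ u : BIdx Q K, dist (bpt Q K u) y' ≤ R₀)
    (hφ : ∀ u, dist (y (φ u)) (y t + A (bpt Q K u + g - (y' + g))) ≤ ε) (u : BIdx Q K) :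
    dist (y (φ u)) (y t) ≤ R₀ + ε := by
  have h1 := hφ u
  have h2 : dist (y t + A (bpt Q K u + g - (y' + g))) (y t) = dist (bpt Q K u) y' := by
    rw [dist_comm, dist_self_add_right, A.norm_map, dist_eq_norm]
    congr 1; abel
  have h3 := dist_triangle (y (φ u)) (y t + A (bpt Q K u + g - (y' + g))) (y t)
  rw [h2] at h3
  linarith [hR₀ u]

/-- **Cross terms of a patch.** Let `y` be injective and `δL`-separated, `Q` `δQ`-separated,
`4ε ≤ δQ`, `2ε < δL`; let the block points be matched by `φ` as above within `R₀ + ε ≤ R − T`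
of the centre `y t`, and let every particle within `R` of `y t` be `ε`-close to the image of a
point of `Q` (the converse matching). Then
`Σ_u Σ_{b ∉ im φ} |y_{φ u} − y_b|⁻⁶ ≤ 64 Σ_u tailSix u + n · 250 δL⁻⁵ T⁻¹`:
near outside particles sit at images of points of `Q` outside the translated block (at least
half their `Q`-distance away), far ones beyond `T`. [folklore] -/
theorem patch_cross_le (hδL : 0 < δL) (hsepL : ∀ k l, k ≠ l → δL ≤ dist (y k) (y l))
    (hδQ : 0 < δQ) (hsepQ : ∀ s ∈ Q.points, ∀ s' ∈ Q.points, s ≠ s' → δQ ≤ dist s s')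
    (hεQ : 4 * ε ≤ δQ) (hεL : 2 * ε < δL) (hg : g ∈ Q.lattice)
    {R₀ R T : ℝ} (hT : 0 < T) (hR : R₀ + ε + T ≤ R)
    (hR₀ : ∀ u : BIdx Q K, dist (bpt Q K u) y' ≤ R₀)
    (hφ : ∀ u, dist (y (φ u)) (y t + A (bpt Q K u + g - (y' + g))) ≤ ε)
    (hmatch : ∀ j, dist (y j) (y t) ≤ R →
      ∃ s ∈ Q.points, dist (y j) (y t + A (s - (y' + g))) ≤ ε) :
    ∑ u : BIdx Q K, ∑ b ∈ (Finset.univ.image φ)ᶜ, (dist (y (φ u)) (y b))⁻¹ ^ 6 ≤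
      64 * ∑ u : BIdx Q K, tailSix Q K u +
        Fintype.card (BIdx Q K) * (250 * δL⁻¹ ^ 5 * T⁻¹) := by
  classical
  set Pim := Finset.univ.image φ with hPim
  have hmemPim : ∀ v, φ v ∈ Pim := fun v => Finset.mem_image_of_mem φ (Finset.mem_univ v)
  -- the bound particle by particle of the patch
  have hu : ∀ u : BIdx Q K, ∑ b ∈ Pimᶜ, (dist (y (φ u)) (y b))⁻¹ ^ 6 ≤
      64 * tailSix Q K u + 250 * δL⁻¹ ^ 5 * T⁻¹ := by
    intro u
    set near := Pimᶜ.filter (fun b => dist (y b) (y t) ≤ R) with hnear_def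
    set far := Pimᶜ.filter (fun b => ¬ dist (y b) (y t) ≤ R) with hfar_def
    have hsplit : ∑ b ∈ Pimᶜ, (dist (y (φ u)) (y b))⁻¹ ^ 6 =
        ∑ b ∈ near, (dist (y (φ u)) (y b))⁻¹ ^ 6 + ∑ b ∈ far, (dist (y (φ u)) (y b))⁻¹ ^ 6 :=
      (Finset.sum_filter_add_sum_filter_not _ _ _).symm
    have hcen := dist_patch_center_le Q K hR₀ hφ u
    -- FAR outside particles are beyond `T` from `y (φ u)`
    have hfar : ∑ b ∈ far, (dist (y (φ u)) (y b))⁻¹ ^ 6 ≤ 250 * δL⁻¹ ^ 5 * T⁻¹ := by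
      have hsub : far ⊆ (Finset.univ.erase (φ u)).filter (fun k => T ≤ dist (y (φ u)) (y k)) := by
        intro b hb
        obtain ⟨hbP, hbR⟩ := Finset.mem_filter.1 hb
        rw [Finset.mem_compl] at hbP
        have hne : b ≠ φ u := fun h => hbP (h ▸ hmemPim u)
        refine Finset.mem_filter.2 ⟨Finset.mem_erase.2 ⟨hne, Finset.mem_univ b⟩, ?_⟩
        have h2 : R < dist (y b) (y t) := not_le.1 hbR
        have h3 := dist_triangle (y b) (y (φ u)) (y t)
        rw [dist_comm (y b) (y (φ u))] at h3
        linarith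
      calc ∑ b ∈ far, (dist (y (φ u)) (y b))⁻¹ ^ 6
          ≤ ∑ k ∈ (Finset.univ.erase (φ u)).filter (fun k => T ≤ dist (y (φ u)) (y k)),
              (dist (y (φ u)) (y k))⁻¹ ^ 6 :=
            Finset.sum_le_sum_of_subset_of_nonneg hsub fun _ _ _ => by positivity
        _ ≤ 250 * δL⁻¹ ^ 5 * T⁻¹ := sum_inv_pow_six_far_le y hδL hsepL (φ u) hT
    -- NEAR outside particles sit at images of points of `Q` outside the translated block
    have hnear : ∑ b ∈ near, (dist (y (φ u)) (y b))⁻¹ ^ 6 ≤ 64 * tailSix Q K u := by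
      have hex : ∀ b ∈ near, ∃ s ∈ Q.points, dist (y b) (y t + A (s - (y' + g))) ≤ ε :=
        fun b hb => hmatch b (Finset.mem_filter.1 hb).2
      choose! s hs hsd using hex
      have hnotin : ∀ b ∈ near, b ∉ Pim := fun b hb =>
        Finset.mem_compl.1 (Finset.mem_filter.1 hb).1
      -- the matched points avoid the translated block
      have hsne : ∀ b ∈ near, ∀ v : BIdx Q K, s b ≠ bpt Q K v + g := by
        intro b hb v hsv
        have h1 := hsd b hb
        rw [hsv] at h1
        have h2 := hφ v
        have h3 := dist_triangle_right (y b) (y (φ v)) (y t + A (bpt Q K v + g - (y' + g)))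
        by_cases hbv : b = φ v
        · exact hnotin b hb (hbv ▸ hmemPim v)
        · have := hsepL b (φ v) hbv
          linarith
      -- and are matched injectively
      have hinj : Set.InjOn s near := by
        intro b hb b' hb' hss
        by_contra hne
        have h1 := hsd b hb
        have h2 := hsd b' hb'
        rw [hss] at h1
        have h3 := dist_triangle_right (y b) (y b') (y t + A (s b' - (y' + g)))
        have := hsepL b b' hne
        linarith
      -- pointwise comparison with the `Q`-distance
      have hpt : ∀ b ∈ near, (dist (y (φ u)) (y b))⁻¹ ^ 6 ≤
          64 * six (dist (bpt Q K u + g) (s b)) := by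
        intro b hb
        set D := dist (bpt Q K u + g) (s b) with hD_def
        have hne : bpt Q K u + g ≠ s b := fun h => hsne b hb u h.symm
        have hD : δQ ≤ D :=
          hsepQ _ (Q.add_mem_points (bpt_mem Q K u) hg) _ (hs b hb) hne
        have hDpos : 0 < D := hδQ.trans_le hD
        have h1 := hφ u
        have h2 := hsd b hb
        have h4 : dist (y t + A (bpt Q K u + g - (y' + g))) (y t + A (s b - (y' + g))) = D := by
          rw [dist_translate_map, hD_def, dist_eq_norm, dist_eq_norm]
          congr 1
          abel
        have h5 := dist_triangle4 (y t + A (bpt Q K u + g - (y' + g))) (y (φ u)) (y b)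
          (y t + A (s b - (y' + g)))
        rw [h4, dist_comm _ (y (φ u))] at h5
        have h6 : D / 2 ≤ dist (y (φ u)) (y b) := by linarith
        have h7 : (dist (y (φ u)) (y b))⁻¹ ≤ 2 * D⁻¹ := by
          rw [show 2 * D⁻¹ = (D / 2)⁻¹ by field_simp]
          exact inv_anti₀ (by positivity) h6
        calc (dist (y (φ u)) (y b))⁻¹ ^ 6 ≤ (2 * D⁻¹) ^ 6 :=
              pow_le_pow_left₀ (inv_nonneg.2 dist_nonneg) h7 6
          _ = 64 * six D := by simp only [six]; ring
      calc ∑ b ∈ near, (dist (y (φ u)) (y b))⁻¹ ^ 6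
          ≤ ∑ b ∈ near, 64 * six (dist (bpt Q K u + g) (s b)) := Finset.sum_le_sum hpt
        _ = 64 * ∑ b ∈ near, six (dist (bpt Q K u + g) (s b)) := by rw [Finset.mul_sum]
        _ ≤ 64 * tailSix Q K u :=
            mul_le_mul_of_nonneg_left (sum_six_le_tailSix Q K u near s hg hs hsne hinj)
              (by norm_num)
    rw [hsplit]
    linarith
  calc ∑ u : BIdx Q K, ∑ b ∈ Pimᶜ, (dist (y (φ u)) (y b))⁻¹ ^ 6
      ≤ ∑ u : BIdx Q K, (64 * tailSix Q K u + 250 * δL⁻¹ ^ 5 * T⁻¹) :=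
        Finset.sum_le_sum fun u _ => hu u
    _ = 64 * ∑ u : BIdx Q K, tailSix Q K u +
          Fintype.card (BIdx Q K) * (250 * δL⁻¹ ^ 5 * T⁻¹) := by
        rw [Finset.sum_add_distrib, Finset.mul_sum, Finset.sum_const, Finset.card_univ,
          nsmul_eq_mul]

end Patch

/-! ## Real-number bookkeeping -/

/-- **Per-patch energy budget.** From the block identity (`2n·e_Q − a·S ≤ 2E_b`, `S` the sum
of the sixth-power tails, `a = δ_Q⁻⁶/12`), the tail bound `S ≤ 2tn`, the excision estimate,
the far-term bound `C_f/6 ≤ η/8` and the choice `(a + 64/3)·t = η/8`: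
`E_M + kn(e_Q − 3η/8) ≤ E_N`. [folklore] -/
theorem patch_budget {EN EM Eb S Cf eQ η t a k n : ℝ} (hk : 0 ≤ k) (hn : 0 ≤ n) (ha : 0 ≤ a)
    (h1 : 2 * n * eQ - a * S ≤ 2 * Eb) (htails : S ≤ t * (2 * n))
    (hsurg : EM + k * (Eb - η / 8 * n) - 1 / 6 * k * (64 * S + n * Cf) ≤ EN)
    (hfar : 1 / 6 * Cf ≤ η / 8) (hct : (a + 64 / 3) * t = η / 8) :
    EM + k * n * (eQ - 3 * η / 8) ≤ EN := by
  have e1 : a * S ≤ a * (t * (2 * n)) := mul_le_mul_of_nonneg_left htails ha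
  have e2 : k * (n * eQ - a * t * n - η / 8 * n) ≤ k * (Eb - η / 8 * n) :=
    mul_le_mul_of_nonneg_left (by linarith) hk
  have e3 : n * (1 / 6 * Cf) ≤ n * (η / 8) := mul_le_mul_of_nonneg_left hfar hn
  have e4 : k * (1 / 6 * (64 * S + n * Cf)) ≤ k * (64 / 3 * t * n + n * (η / 8)) :=
    mul_le_mul_of_nonneg_left (by linarith) hk
  have e5 : k * n * ((a + 64 / 3) * t) = k * n * (η / 8) := by rw [hct]
  linarith [e5]

/-- **Thermodynamic bookkeeping**: if `E_N ≤ N(e + η₃)`, `(N − kn)(e − η₃) ≤ E_M`,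
`E_M + kn(e_Q − a) ≤ E_N`, `2η₃N ≤ b·kn` and `kn > 0`, then `e_Q ≤ e + a + b`. [folklore] -/
theorem thermo_bookkeeping {EN EM e eQ η₃ a b kn Nr : ℝ} (hkn : 0 < kn) (hη₃ : 0 ≤ η₃)
    (hEN : EN ≤ Nr * (e + η₃)) (hEM : (Nr - kn) * (e - η₃) ≤ EM)
    (hsurg : EM + kn * (eQ - a) ≤ EN) (hb : 2 * η₃ * Nr ≤ b * kn) : eQ ≤ e + a + b := by
  have h0 : 0 ≤ kn * η₃ := mul_nonneg hkn.le hη₃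
  have h2 : kn * (eQ - a) ≤ kn * (e + b) := by linarith
  have h3 : eQ - a ≤ e + b := le_of_mul_le_mul_left h2 hkn
  linarith

/-! ## Choosing the patches to excise -/

/-- **Many well-separated good particles.** If `ρN ≤ #G` for a set `G` of particles of a
`δ`-separated configuration `y`, `c ≤ ρ/(4R/δ + 1)³` and `cN ≥ 2`, then `G` contains
`⌊cN⌋ ≥ 1` particles at mutual distances `> 2R` (a maximal `2R`-separated sub-family of `G` is
a `2R`-net of `G`, and `2R`-balls hold at most `(4R/δ + 1)³` particles). [folklore] -/
theorem exists_separated_subfamily {N : ℕ} (y : Fin N → E3) {δ : ℝ} (hδ : 0 < δ)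
    (hsep : ∀ k l, k ≠ l → δ ≤ dist (y k) (y l)) (G : Finset (Fin N)) {ρ R c : ℝ} (hR : 0 < R)
    (hG : ρ * N ≤ G.card) (hc : c ≤ ρ / (2 * (2 * R) / δ + 1) ^ 3) (hcN : 2 ≤ c * N) :
    ∃ T' ⊆ G, T'.card = ⌊c * N⌋₊ ∧ 1 ≤ T'.card ∧
      ∀ t ∈ T', ∀ t' ∈ T', t ≠ t' → 2 * R < dist (y t) (y t') := by
  have hCp : 0 < (2 * (2 * R) / δ + 1) ^ 3 := by positivity
  obtain ⟨Tn, hTnG, hsepT, hnet⟩ := exists_separated_net G y (show (0 : ℝ) ≤ 2 * R by positivity)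
  have hTncard : ρ * N ≤ Tn.card * (2 * (2 * R) / δ + 1) ^ 3 := by
    refine hG.trans (card_le_card_net_mul y hnet fun t _ => ?_)
    exact card_ball_le_of_separated y hδ hsep G t (by positivity)
  have hN : (0 : ℝ) ≤ N := Nat.cast_nonneg N
  have hkTn : ⌊c * N⌋₊ ≤ Tn.card := by
    have h1 : (⌊c * N⌋₊ : ℝ) ≤ Tn.card := by
      have h2 : c * N ≤ ρ / (2 * (2 * R) / δ + 1) ^ 3 * N := mul_le_mul_of_nonneg_right hc hN
      have h3 : ρ / (2 * (2 * R) / δ + 1) ^ 3 * N ≤ Tn.card := by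
        rw [div_mul_eq_mul_div, div_le_iff₀ hCp]; exact hTncard
      exact (Nat.floor_le (by linarith)).trans (h2.trans h3)
    exact_mod_cast h1
  obtain ⟨T', hT'Tn, hT'card⟩ := Finset.exists_subset_card_eq hkTn
  refine ⟨T', hT'Tn.trans hTnG, hT'card, ?_, fun t ht t' ht' hne =>
    hsepT t (hT'Tn ht) t' (hT'Tn ht') hne⟩
  rw [hT'card]
  exact (Nat.one_le_floor_iff _).2 (by linarith)


end Summit.AtomisticToContinuum.Crystallization.Theorems.ChargedPeriodicOptimal

end
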